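import Literature.NumberTheory.LFunctions.MoebiusWalshVaughan
import HarnessLib

/-!
# Binary carries and the truncation of Walsh products (Bourgain 2013, §2, "cf. Lemma 5 in [M-R]")
# — proved

Topic `Literature/NumberTheory/LFunctions`, a proofs companion of `MoebiusWalshCircuits.lean`
(named facts `bourgain_moebius_walsh_uniform`, `bourgain_liouville_walsh_uniform`: J. Bourgain,
*Möbius–Walsh correlation bounds and an estimate of Mauduit and Rivat*, J. Anal. Math. 119 (2013)
147–163 = arXiv:1109.2784, Theorem 1). Everything here is PROVED (theorems only; no definition,
no named fact); the Walsh character on `ℕ` is `MoebiusWalshVaughan.natWalsh`.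

Bourgain, §2, after (2.2): "Comparing the binary expansions of `mn` and `mn + ℓm2^K`, the `K` first
digits remain and we can assume that also digits `j > K + μ + ρ + ερ` are unchanged provided in
(2.2) we introduce an additional error term of the order `2^{-ερ} M²N²` (cf. Lemma 5 in [M-R])."
Mauduit–Rivat's Lemme 5 (Ann. of Math. 171 (2010), §6.2) counts the exceptions through the
divisor bound `τ(a) ≪_ε a^ε`, which would cost `X^ε` — fatal for Bourgain's sub-power saving; what
the dyadic setting needs (and what we prove) is the following exact digital statement plus a
direct count in arithmetic progressions:

* `testBit_add_mul_two_pow_of_lt` — adding a multiple of `2^K` does not change the digits below `K`;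
* `testBit_add_of_testBit_false` — **no carry beyond a clear digit**: if `y < 2^P`, `P ≤ j < Q`
  and the digit `j` of `x` is `0`, then `x + y` and `x` have the same digits at all positions
  `≥ Q` (the carry of `x + y` cannot propagate through position `j`; `mod_add_lt_two_pow`);
* `natWalsh_add_mul_natWalsh_eq` — hence, for `y < 2^P` a multiple of `2^K` and `x` NOT having all
  its digits `1` on `[P, P+t)`, `w_T(x + y) w_T(x) = w_{T'}(x + y) w_{T'}(x)` with
  `T' = T ∩ [K, P + t)` (the digits outside `[K, P+t)` agree and cancel in the product,
  `natWalsh_mul_natWalsh_eq_filter`);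
* `card_filter_digits_all_one_le` — **the exceptional set is small**: for `m ≥ 1`, among
  `n ∈ [N₀, N₀ + N)` at most `(mN/2^{P+t} + 2)(2^P/m + 1)` have all the digits of `mn` on
  `[P, P+t)` equal to `1` (such `n` have `mn mod 2^{P+t} ≥ 2^{P+t} - 2^P`,
  `two_pow_sub_le_mod_of_testBit`; for each value of `⌊mn/2^{P+t}⌋` they form a progression
  segment of length `≤ 2^P/m + 1`, `card_filter_mul_mod_ge_le`).

In Bourgain's setting (`x = mn`, `y = ℓ m 2^K`, `m < 2^{μ+2}`, `ℓ < L = 2^ρ`, `P = K + μ + 2 + ρ`,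
`N = 2^ν` with `K + ρ + t + 2 ≤ ν`) the count is `≤ 4N 2^{-t} + 2` per `(m, ℓ)`, i.e. the relative
error `2^{-t} = 2^{-ερ}` of the quotation with `t = ερ`.

## References

* J. Bourgain, J. Anal. Math. 119 (2013) 147–163, §2, between (2.2) and (2.3). [Bourgain2013MoebiusWalsh]
* C. Mauduit, J. Rivat, Ann. of Math. 171 (2010) 1591–1646, §6.2, Lemme 5 (the `q`-ary original,
  via the divisor bound).
-/

open Finset

namespace Literature.NumberTheory.LFunctions.MoebiusWalsh

open Literature.NumberTheory.LFunctions.MoebiusWalshVaughan (natWalsh)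

/-- Digits below `K` are unchanged by adding a multiple of `2^K`.
[cite: Bourgain2013MoebiusWalsh, §2 ("the K first digits remain")] -/
theorem testBit_add_mul_two_pow_of_lt (x c K : ℕ) {i : ℕ} (hi : i < K) :
    (x + 2 ^ K * c).testBit i = x.testBit i := by
  have hx : x = 2 ^ K * (x / 2 ^ K) + x % 2 ^ K := (Nat.div_add_mod x (2 ^ K)).symm
  have hlt : x % 2 ^ K < 2 ^ K := Nat.mod_lt _ (Nat.two_pow_pos K)
  conv_lhs => rw [hx, show 2 ^ K * (x / 2 ^ K) + x % 2 ^ K + 2 ^ K * c =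
    2 ^ K * (x / 2 ^ K + c) + x % 2 ^ K by ring]
  conv_rhs => rw [hx]
  rw [Nat.testBit_two_pow_mul_add _ hlt, Nat.testBit_two_pow_mul_add _ hlt, if_pos hi, if_pos hi]

/-- No overflow past a clear digit: `z % 2^Q + y < 2^Q` whenever `y < 2^P`, `P ≤ j < Q` and the
digit `j` of `z` is `0`. [folklore] -/
theorem mod_add_lt_two_pow {z y P Q j : ℕ} (hy : y < 2 ^ P) (hPj : P ≤ j) (hjQ : j < Q)
    (hj : z.testBit j = false) : z % 2 ^ Q + y < 2 ^ Q := by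
  set z' := z % 2 ^ Q with hz'
  have hz'lt : z' < 2 ^ Q := Nat.mod_lt _ (Nat.two_pow_pos Q)
  have hbit : z'.testBit j = false := by
    rw [hz', Nat.testBit_mod_two_pow, hj, Bool.and_false]
  -- `z' / 2^j` is even
  have heven : z' / 2 ^ j % 2 = 0 := by
    have h := hbit
    rw [Nat.testBit_eq_decide_div_mod_eq] at h
    simp only [decide_eq_false_iff_not] at h
    omega
  have hdecomp : z' = 2 ^ j * (z' / 2 ^ j) + z' % 2 ^ j := (Nat.div_add_mod z' (2 ^ j)).symm
  have hmodlt : z' % 2 ^ j < 2 ^ j := Nat.mod_lt _ (Nat.two_pow_pos j)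
  obtain ⟨c, hc⟩ : ∃ c, z' / 2 ^ j = 2 * c := ⟨z' / 2 ^ j / 2, by omega⟩
  -- `2^(j+1) * c < 2^Q`, hence `2^(j+1) * c ≤ 2^Q - 2^(j+1)`
  have hQ : 2 ^ Q = 2 ^ (j + 1) * 2 ^ (Q - (j + 1)) := by
    rw [← pow_add]; congr 1; omega
  have hjs' : 2 ^ (j + 1) * c = 2 ^ j * (2 * c) := by rw [pow_succ]; ring
  have hdecomp' : z' = 2 ^ j * (2 * c) + z' % 2 ^ j := by rw [← hc]; exact hdecomp
  have hc_lt : c < 2 ^ (Q - (j + 1)) := by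
    have h1 : 2 ^ (j + 1) * c ≤ z' := by omega
    have h2 : 2 ^ (j + 1) * c < 2 ^ (j + 1) * 2 ^ (Q - (j + 1)) := by rw [← hQ]; omega
    exact Nat.lt_of_mul_lt_mul_left h2
  have hPj' : 2 ^ P ≤ 2 ^ j := Nat.pow_le_pow_right Nat.two_pos hPj
  have hjs : 2 ^ (j + 1) = 2 * 2 ^ j := by rw [pow_succ]; ring
  have hc_le : 2 ^ (j + 1) * (c + 1) ≤ 2 ^ Q := by
    rw [hQ]; exact Nat.mul_le_mul_left _ hc_lt
  calc z' + y = 2 ^ j * (2 * c) + z' % 2 ^ j + y := by rw [← hdecomp']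
    _ < 2 ^ j * (2 * c) + 2 ^ j + 2 ^ P := by omega
    _ ≤ 2 ^ j * (2 * c) + 2 ^ j + 2 ^ j := by omega
    _ = 2 ^ (j + 1) * (c + 1) := by rw [hjs]; ring
    _ ≤ 2 ^ Q := hc_le

/-- **No carry beyond a clear digit.** If `y < 2^P`, `P ≤ j < Q`, and the digit `j` of `x` is `0`,
then the digits of `x + y` at positions `≥ Q` are those of `x`.
[cite: Bourgain2013MoebiusWalsh, §2 ("digits j > K+μ+ρ+ερ are unchanged"); cf. [M-R] Lemme 5] -/
theorem testBit_add_of_testBit_false {x y P Q j : ℕ} (hy : y < 2 ^ P) (hPj : P ≤ j) (hjQ : j < Q)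
    (hj : x.testBit j = false) {i : ℕ} (hi : Q ≤ i) : (x + y).testBit i = x.testBit i := by
  have hx : x = 2 ^ Q * (x / 2 ^ Q) + x % 2 ^ Q := (Nat.div_add_mod x (2 ^ Q)).symm
  have hlt : x % 2 ^ Q + y < 2 ^ Q := mod_add_lt_two_pow hy hPj hjQ hj
  have hlt' : x % 2 ^ Q < 2 ^ Q := Nat.mod_lt _ (Nat.two_pow_pos Q)
  conv_lhs => rw [hx, add_assoc]
  conv_rhs => rw [hx]
  rw [Nat.testBit_two_pow_mul_add _ hlt, Nat.testBit_two_pow_mul_add _ hlt',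
    if_neg (Nat.not_lt.mpr hi), if_neg (Nat.not_lt.mpr hi)]

/-- If all the binary digits of `z` at positions `P, …, P + t - 1` equal `1`, then
`z % 2^(P+t) ≥ 2^(P+t) - 2^P`. [folklore] -/
theorem two_pow_sub_le_mod_of_testBit {z P t : ℕ}
    (h : ∀ j, P ≤ j → j < P + t → z.testBit j = true) :
    2 ^ (P + t) - 2 ^ P ≤ z % 2 ^ (P + t) := by
  have hmod : z % 2 ^ (P + t) = z % 2 ^ P + 2 ^ P * (z / 2 ^ P % 2 ^ t) := by
    rw [pow_add, Nat.mod_mul]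
  have hall : z / 2 ^ P % 2 ^ t = 2 ^ t - 1 := by
    apply Nat.eq_of_testBit_eq
    intro i
    rw [Nat.testBit_mod_two_pow, Nat.testBit_div_two_pow, Nat.testBit_two_pow_sub_one]
    by_cases hi : i < t
    · rw [decide_eq_true hi, Bool.true_and, h (i + P) (by omega) (by omega)]
    · rw [decide_eq_false hi, Bool.false_and]
  rw [hmod, hall, Nat.mul_sub, mul_one, ← pow_add]
  omega

/-- **Counting the carry-prone multiples.** For `m ≥ 1` and `Q = 2^(P+t)`, the number of
`n ∈ [N₀, N₀ + N)` with `m n mod Q ≥ Q - 2^P` is at most `(m N / Q + 2) (2^P / m + 1)`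
(the map `n ↦ (⌊mn/Q⌋, ⌊(mn mod Q - (Q - 2^P))/m⌋)` is injective on this set). [folklore] -/
theorem card_filter_mul_mod_ge_le {m : ℕ} (hm : 0 < m) (N₀ N P t : ℕ) :
    #{n ∈ Ico N₀ (N₀ + N) | 2 ^ (P + t) - 2 ^ P ≤ m * n % 2 ^ (P + t)} ≤
      (m * N / 2 ^ (P + t) + 2) * (2 ^ P / m + 1) := by
  have hQpos : 0 < 2 ^ (P + t) := Nat.two_pow_pos _
  have hPQ : 2 ^ P ≤ 2 ^ (P + t) := Nat.pow_le_pow_right Nat.two_pos (Nat.le_add_right P t)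
  generalize 2 ^ (P + t) = Q at hQpos hPQ ⊢
  set bad := {n ∈ Ico N₀ (N₀ + N) | Q - 2 ^ P ≤ m * n % Q} with hbad
  -- the map `n ↦ (m n / Q, (m n % Q - (Q - 2^P)) / m)`
  let φ : ℕ → ℕ × ℕ := fun n => (m * n / Q, (m * n % Q - (Q - 2 ^ P)) / m)
  have hmaps : ∀ n ∈ bad, φ n ∈ (Icc (m * N₀ / Q) (m * (N₀ + N) / Q)) ×ˢ (range (2 ^ P / m + 1)) := by
    intro n hn
    rw [hbad, mem_filter, mem_Ico] at hn
    obtain ⟨⟨h1, h2⟩, h3⟩ := hn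
    rw [mem_product, mem_Icc, mem_range]
    refine ⟨⟨Nat.div_le_div_right (Nat.mul_le_mul_left m h1),
      Nat.div_le_div_right (Nat.mul_le_mul_left m h2.le)⟩, ?_⟩
    have hlt : m * n % Q < Q := Nat.mod_lt _ hQpos
    show (m * n % Q - (Q - 2 ^ P)) / m < 2 ^ P / m + 1
    exact Nat.lt_succ_of_le (Nat.div_le_div_right (by omega))
  have hinj : Set.InjOn φ bad := by
    intro n hn n' hn' heq
    simp only [hbad, coe_filter, mem_Ico, Set.mem_setOf_eq] at hn hn'
    simp only [φ, Prod.mk.injEq] at heq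
    obtain ⟨hc, hr⟩ := heq
    have e1 := Nat.div_add_mod (m * n) Q
    have e2 := Nat.div_add_mod (m * n') Q
    rw [hc] at e1
    have f1 := Nat.div_add_mod (m * n % Q - (Q - 2 ^ P)) m
    have f2 := Nat.div_add_mod (m * n' % Q - (Q - 2 ^ P)) m
    rw [hr] at f1
    have g1 := Nat.mod_lt (m * n % Q - (Q - 2 ^ P)) hm
    have g2 := Nat.mod_lt (m * n' % Q - (Q - 2 ^ P)) hm
    have hA := hn.2
    have hA' := hn'.2
    have h1 : m * n < m * n' + m := by omega
    have h2 : m * n' < m * n + m := by omega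
    have h1' : n < n' + 1 := Nat.lt_of_mul_lt_mul_left (by rw [mul_add, mul_one]; exact h1)
    have h2' : n' < n + 1 := Nat.lt_of_mul_lt_mul_left (by rw [mul_add, mul_one]; exact h2)
    omega
  calc #bad ≤ #((Icc (m * N₀ / Q) (m * (N₀ + N) / Q)) ×ˢ (range (2 ^ P / m + 1))) :=
        card_le_card_of_injOn φ hmaps hinj
    _ = (m * (N₀ + N) / Q + 1 - m * N₀ / Q) * (2 ^ P / m + 1) := by
        rw [card_product, Nat.card_Icc, card_range]
    _ ≤ (m * N / Q + 2) * (2 ^ P / m + 1) := by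
        refine Nat.mul_le_mul_right _ ?_
        have : m * (N₀ + N) / Q ≤ m * N₀ / Q + m * N / Q + 1 := by
          rw [mul_add, Nat.add_div hQpos]
          split_ifs <;> omega
        have h0 := Nat.zero_le (m * N / Q)
        have h1 := Nat.zero_le (m * N₀ / Q)
        omega



/-! ### Walsh products: truncation of the digit set -/

/-- Digits outside `[K, Q)` cancel in the product `w_T(x') w_T(x)` when they agree:
`w_T(x') w_T(x) = w_{T ∩ [K,Q)}(x') w_{T ∩ [K,Q)}(x)`. [folklore] -/
theorem natWalsh_mul_natWalsh_eq_filter (T : Finset ℕ) {x x' K Q : ℕ}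
    (h : ∀ i, ¬ (K ≤ i ∧ i < Q) → x'.testBit i = x.testBit i) :
    natWalsh T x' * natWalsh T x =
      natWalsh (T.filter (fun j => K ≤ j ∧ j < Q)) x' *
        natWalsh (T.filter (fun j => K ≤ j ∧ j < Q)) x := by
  unfold natWalsh
  rw [← prod_mul_distrib, ← prod_mul_distrib,
    ← prod_filter_mul_prod_filter_not T (fun j => K ≤ j ∧ j < Q)]
  have h1 : ∏ j ∈ T.filter (fun j => ¬ (K ≤ j ∧ j < Q)),
      ((if x'.testBit j then (-1 : ℝ) else 1) * (if x.testBit j then (-1 : ℝ) else 1)) = 1 := by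
    refine prod_eq_one fun j hj => ?_
    rw [mem_filter] at hj
    rw [h j hj.2]
    split_ifs <;> norm_num
  rw [h1, mul_one]

/-- **Carry truncation of a Walsh product** (Bourgain 2013 §2, "cf. Lemma 5 in [M-R]"): if
`y < 2^P` is a multiple of `2^K` and NOT all the digits of `x` at positions `P, …, P+t-1` equal
`1`, then `w_T(x + y) w_T(x) = w_{T'}(x + y) w_{T'}(x)` with `T' = T ∩ [K, P + t)`.
[cite: Bourgain2013MoebiusWalsh, §2 (w_S(mn)w_S(m(n+ℓ2^K)) `=' w_{S'}(mn)w_{S'}(m(n+ℓ2^K)))] -/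
theorem natWalsh_add_mul_natWalsh_eq {T : Finset ℕ} {x y K P t : ℕ} (hy : y < 2 ^ P)
    (hKy : 2 ^ K ∣ y) (hdig : ∃ j, P ≤ j ∧ j < P + t ∧ x.testBit j = false) :
    natWalsh T (x + y) * natWalsh T x =
      natWalsh (T.filter (fun j => K ≤ j ∧ j < P + t)) (x + y) *
        natWalsh (T.filter (fun j => K ≤ j ∧ j < P + t)) x := by
  obtain ⟨j, hPj, hjt, hj⟩ := hdig
  obtain ⟨c, rfl⟩ := hKy
  refine natWalsh_mul_natWalsh_eq_filter T fun i hi => ?_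
  by_cases hiK : i < K
  · exact testBit_add_mul_two_pow_of_lt x c K hiK
  · have hiQ : P + t ≤ i := by omega
    exact testBit_add_of_testBit_false hy hPj hjt hj hiQ

/-- **The exceptional set of the carry truncation is small**: for `m ≥ 1` the number of
`n ∈ [N₀, N₀ + N)` ALL of whose product digits `(mn)_j`, `P ≤ j < P + t`, equal `1` is at most
`(m N / 2^(P+t) + 2) (2^P / m + 1)`.
[cite: Bourgain2013MoebiusWalsh, §2 ("an additional error term of the order 2^{-ερ}M²N²")] -/
theorem card_filter_digits_all_one_le {m : ℕ} (hm : 0 < m) (N₀ N P t : ℕ) :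
    #{n ∈ Ico N₀ (N₀ + N) | ∀ j, P ≤ j → j < P + t → (m * n).testBit j = true} ≤
      (m * N / 2 ^ (P + t) + 2) * (2 ^ P / m + 1) := by
  refine le_trans (card_le_card ?_) (card_filter_mul_mod_ge_le hm N₀ N P t)
  intro n hn
  rw [mem_filter] at hn ⊢
  exact ⟨hn.1, two_pow_sub_le_mod_of_testBit hn.2⟩

/-- Packaging: either some digit in `[P, P+t)` of `m n` vanishes (and the carry truncation
`natWalsh_add_mul_natWalsh_eq` applies to `x = m n`), or `n` lies in the exceptional set of
`card_filter_digits_all_one_le`. [folklore] -/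
theorem exists_testBit_false_or {m n P t : ℕ} :
    (∃ j, P ≤ j ∧ j < P + t ∧ (m * n).testBit j = false) ∨
      (∀ j, P ≤ j → j < P + t → (m * n).testBit j = true) := by
  by_cases h : ∀ j, P ≤ j → j < P + t → (m * n).testBit j = true
  · exact Or.inr h
  · left
    push Not at h
    obtain ⟨j, h1, h2, h3⟩ := h
    exact ⟨j, h1, h2, by simpa using h3⟩

end Literature.NumberTheory.LFunctions.MoebiusWalsh
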